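import Literature.AlgebraicGeometry.Motives.MixedHodgeExtensionSocle
import HarnessLib

/-!
# Indecomposable mixed Hodge structures; Fitting's lemma; indecomposable direct summands

In the abelian category of mixed Hodge structures (Cattani–El Zein–Griffiths–Lê, *Hodge Theory*, Thm. 3.2.18;
semisimple objects p. 270) on finite-dimensional spaces every object is a finite direct sum of indecomposable ones,
and — unlike for pure polarizable Hodge structures — indecomposable is much weaker than simple: a non-split extension
of simple MHS (Carlson, §2(b)) is indecomposable but not simple (Ch. 12 footnote 2, p. 527: the `ℚ`-split MHS are
exactly those with "no nontrivial extensions"). Namespace `MixedHodgeStructure`; everything proved, no named facts: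

* §1 powers `f.npow n` of an endomorphism (a morphism of MHS; underlying map `f ^ n`).
* §2 **`IsIndecomposable H`** (non-zero, no decomposition `H = S ⊕ T` into non-zero sub-MHS); simple ⇒
  indecomposable; indecomposable + semisimple ⇒ simple; isomorphism invariance; **non-split extensions of simple
  MHS are indecomposable** (`Extension.isIndecomposable_of_not_isSplit`).
* §3 **Fitting's lemma for MHS**: `H = Ker fⁿ ⊕ Im fⁿ` as sub-MHS for `n ≫ 0`; for indecomposable `H` every
  endomorphism is **bijective or nilpotent**, and `f` or `id − f` is bijective (`End_MHS(H)` is local).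
* §4 every non-zero MHS has an indecomposable direct summand (a summand of least positive dimension).

## References

* [CattaniElZeinGriffithsLe2014] E. Cattani et al. (eds.), Hodge Theory (2014), Thm. 3.2.18, Lemma 3.2.20, p. 270,
  Ch. 12 footnote 2 (p. 527).
* [Carlson1980] J. Carlson, Extensions of mixed Hodge structures (Angers 1979), §2(b).
-/

noncomputable section

namespace Literature.AlgebraicGeometry.Motives

namespace MixedHodgeStructure

universe u v w

variable {V : Type u} [AddCommGroup V] [Module ℚ V]
variable {V' : Type v} [AddCommGroup V'] [Module ℚ V']
variable {H : MixedHodgeStructure V} {H' : MixedHodgeStructure V'}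

open Module

/-! ### §1 Powers of an endomorphism -/

/-- The `n`-th power `fⁿ` of an endomorphism of MHS. [cite: CattaniElZeinGriffithsLe2014, Thm. 3.2.18] -/
def Hom.npow (f : Hom H H) : ℕ → Hom H H
  | 0 => Hom.id H
  | n + 1 => (Hom.npow f n).comp f

/-- The underlying map of `fⁿ` is `f.toLinearMap ^ n`. [cite: CattaniElZeinGriffithsLe2014, Thm. 3.2.18] -/
theorem Hom.npow_toLinearMap (f : Hom H H) (n : ℕ) : (f.npow n).toLinearMap = f.toLinearMap ^ n := by
  induction n with
  | zero => rw [pow_zero]; rfl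
  | succ n ih => rw [Hom.npow, Hom.comp_toLinearMap, ih, pow_succ, Module.End.mul_eq_comp]

/-! ### §2 Indecomposable mixed Hodge structures -/

variable (H) in
/-- **`H` is indecomposable**: `H ≠ 0` and in every decomposition `H = S ⊕ T` into sub-MHS one summand is `0`.
[cite: CattaniElZeinGriffithsLe2014, Thm. 3.2.18 and p. 270] -/
def IsIndecomposable : Prop :=
  Nontrivial V ∧ ∀ S T : SubMixedHodgeStructure H, IsCompl S.toSubmodule T.toSubmodule →
    S.toSubmodule = ⊥ ∨ T.toSubmodule = ⊥

/-- An indecomposable MHS is non-zero. [cite: CattaniElZeinGriffithsLe2014, p. 270] -/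
theorem IsIndecomposable.nontrivial (h : H.IsIndecomposable) : Nontrivial V := h.1

/-- The defining property. [cite: CattaniElZeinGriffithsLe2014, p. 270] -/
theorem IsIndecomposable.eq_bot_or_eq_bot (h : H.IsIndecomposable) (S T : SubMixedHodgeStructure H)
    (hST : IsCompl S.toSubmodule T.toSubmodule) : S.toSubmodule = ⊥ ∨ T.toSubmodule = ⊥ :=
  h.2 S T hST

/-- In a decomposition of an indecomposable MHS a non-zero summand is everything. [cite: CattaniElZeinGriffithsLe2014, p. 270] -/
theorem IsIndecomposable.eq_top_of_ne_bot (h : H.IsIndecomposable) (S T : SubMixedHodgeStructure H)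
    (hST : IsCompl S.toSubmodule T.toSubmodule) (hS : S.toSubmodule ≠ ⊥) : S.toSubmodule = ⊤ := by
  rcases h.2 S T hST with h' | h'
  · exact absurd h' hS
  · rw [h'] at hST
    exact eq_top_of_isCompl_bot hST

/-- **Simple MHS are indecomposable.** [cite: CattaniElZeinGriffithsLe2014, p. 270] -/
theorem IsSimple.isIndecomposable (h : H.IsSimple) : H.IsIndecomposable := by
  refine ⟨h.nontrivial, fun S T hST => ?_⟩
  rcases h.eq_bot_or_eq_top S with hS | hS
  · exact Or.inl hS
  · rw [hS] at hST
    exact Or.inr (eq_bot_of_top_isCompl hST)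

/-- **An indecomposable semisimple MHS is simple.** [cite: CattaniElZeinGriffithsLe2014, p. 270] -/
theorem IsIndecomposable.isSimple_of_isSemisimple (h : H.IsIndecomposable) (hs : H.IsSemisimple) : H.IsSimple := by
  haveI := h.nontrivial
  refine ⟨h.nontrivial, fun S => ?_⟩
  obtain ⟨T, hT⟩ := hs S
  rcases h.2 S T hT with hS | hT'
  · exact Or.inl hS
  · rw [hT'] at hT
    exact Or.inr (eq_top_of_isCompl_bot hT)

/-- For semisimple `H`: indecomposable iff simple. [cite: CattaniElZeinGriffithsLe2014, p. 270] -/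
theorem IsSemisimple.isIndecomposable_iff (hs : H.IsSemisimple) : H.IsIndecomposable ↔ H.IsSimple :=
  ⟨fun h => h.isSimple_of_isSemisimple hs, IsSimple.isIndecomposable⟩

/-- Complementary sub-MHS pull back to complementary sub-MHS along an isomorphism. [cite: CattaniElZeinGriffithsLe2014, Lemma 3.2.20] -/
theorem isCompl_comap_of_bijective (f : Hom H H') (hf : Function.Bijective f.toLinearMap)
    (S T : SubMixedHodgeStructure H') (hST : IsCompl S.toSubmodule T.toSubmodule) :
    IsCompl (S.comap f).toSubmodule (T.comap f).toSubmodule := by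
  rw [SubMixedHodgeStructure.comap_toSubmodule, SubMixedHodgeStructure.comap_toSubmodule]
  refine ⟨disjoint_iff.2 (eq_bot_iff.2 fun x hx => ?_), codisjoint_iff.2 (eq_top_iff.2 fun x _ => ?_)⟩
  · have h0 : f.toLinearMap x ∈ S.toSubmodule ⊓ T.toSubmodule := hx
    rw [hST.inf_eq_bot, Submodule.mem_bot, ← map_zero f.toLinearMap] at h0
    exact (Submodule.mem_bot ℚ).2 (hf.1 h0)
  · have hx : f.toLinearMap x ∈ S.toSubmodule ⊔ T.toSubmodule := by rw [hST.sup_eq_top]; exact Submodule.mem_top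
    obtain ⟨s, hs, t, ht, hst⟩ := Submodule.mem_sup.1 hx
    obtain ⟨a, rfl⟩ := hf.2 s
    obtain ⟨b, rfl⟩ := hf.2 t
    have hab : x = a + b := hf.1 (by rw [map_add, hst])
    rw [hab]
    exact Submodule.add_mem_sup hs ht

/-- **Indecomposability is invariant under isomorphisms.** [cite: CattaniElZeinGriffithsLe2014, Thm. 3.2.18] -/
theorem IsIndecomposable.of_bijective (h : H.IsIndecomposable) (f : Hom H H') (hf : Function.Bijective f.toLinearMap) :
    H'.IsIndecomposable := by
  haveI := h.nontrivial
  refine ⟨hf.1.nontrivial, fun S T hST => ?_⟩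
  have hS : S.toSubmodule = (S.toSubmodule.comap f.toLinearMap).map f.toLinearMap :=
    (Submodule.map_comap_eq_of_surjective hf.2 _).symm
  have hT : T.toSubmodule = (T.toSubmodule.comap f.toLinearMap).map f.toLinearMap :=
    (Submodule.map_comap_eq_of_surjective hf.2 _).symm
  rcases h.2 (S.comap f) (T.comap f) (isCompl_comap_of_bijective f hf S T hST) with h' | h' <;>
    rw [SubMixedHodgeStructure.comap_toSubmodule] at h'
  · left
    rw [hS, h', Submodule.map_bot]
  · right
    rw [hT, h', Submodule.map_bot]

/-- Isomorphic MHS are simultaneously indecomposable. [cite: CattaniElZeinGriffithsLe2014, Thm. 3.2.18] -/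
theorem isIndecomposable_iff_of_bijective (f : Hom H H') (hf : Function.Bijective f.toLinearMap) :
    H.IsIndecomposable ↔ H'.IsIndecomposable :=
  ⟨fun h => h.of_bijective f hf, fun h => h.of_bijective (f.inverse hf) (by
    rw [Hom.inverse_toLinearMap]; exact (LinearEquiv.ofBijective f.toLinearMap hf).symm.bijective)⟩

/-- **A non-split extension of simple MHS is indecomposable** (its sub-MHS are `0`, `i(B)`, `E`, and `i(B)` has no
complement). [cite: Carlson1980, §2(b)] [cite: CattaniElZeinGriffithsLe2014, p. 270 and Ch. 12 footnote 2 (p. 527)] -/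
theorem Extension.isIndecomposable_of_not_isSplit {VA : Type u} [AddCommGroup VA] [Module ℚ VA]
    {VB : Type v} [AddCommGroup VB] [Module ℚ VB] {VE : Type w} [AddCommGroup VE] [Module ℚ VE]
    {A : MixedHodgeStructure VA} {B : MixedHodgeStructure VB} (E : Extension A B VE) (hA : A.IsSimple)
    (hB : B.IsSimple) (h : ¬E.IsSplit) : E.mhs.IsIndecomposable := by
  haveI := hB.nontrivial
  refine ⟨E.injective_inc.nontrivial, fun S T hST => ?_⟩
  rcases E.eq_bot_or_eq_range_inc_or_eq_top_of_not_isSplit hA hB h S with hS | hS | hS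
  · exact Or.inl hS
  · rw [hS] at hST
    exact absurd (E.isSplit_of_isCompl_range_inc T hST) h
  · rw [hS] at hST
    exact Or.inr (eq_bot_of_top_isCompl hST)

/-- A non-split extension of simple MHS is indecomposable but not simple. [cite: Carlson1980, §2(b)] -/
theorem Extension.not_isSimple_of_not_isSplit {VA : Type u} [AddCommGroup VA] [Module ℚ VA]
    {VB : Type v} [AddCommGroup VB] [Module ℚ VB] {VE : Type w} [AddCommGroup VE] [Module ℚ VE]
    {A : MixedHodgeStructure VA} {B : MixedHodgeStructure VB} (E : Extension A B VE) (hA : A.IsSimple)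
    (h : ¬E.IsSplit) : ¬E.mhs.IsSimple := fun hs => by
  haveI := hA.nontrivial
  rcases hs.eq_bot_or_eq_top E.inc.range with h' | h' <;> rw [Hom.range_toSubmodule] at h'
  · -- `i(B) = 0`: then `π` is bijective and `E` splits
    refine h (E.isSplit_of_isCompl_range_inc (SubMixedHodgeStructure.top E.mhs) ?_)
    rw [h', SubMixedHodgeStructure.top_toSubmodule]
    exact isCompl_bot_top
  · -- `i(B) = E`: then `A = 0`
    obtain ⟨a, ha⟩ := exists_ne (0 : VA)
    obtain ⟨e, rfl⟩ := E.surjective_proj a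
    have he : e ∈ LinearMap.range E.inc.toLinearMap := by rw [h']; exact Submodule.mem_top
    rw [E.range_inc, LinearMap.mem_ker] at he
    exact ha he

/-! ### §3 Fitting's lemma -/

section Fitting

variable [FiniteDimensional ℚ V]

/-- **Fitting decomposition `H = Ker fⁿ ⊕ Im fⁿ` by sub-MHS for large `n`.** [cite: CattaniElZeinGriffithsLe2014, Thm. 3.2.18] -/
theorem Hom.exists_isCompl_ker_npow_range_npow (f : Hom H H) :
    ∃ n : ℕ, 0 < n ∧ IsCompl (f.npow n).ker.toSubmodule (f.npow n).range.toSubmodule := by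
  obtain ⟨N, hN⟩ := Filter.eventually_atTop.1 (LinearMap.eventually_isCompl_ker_pow_range_pow f.toLinearMap)
  refine ⟨N + 1, Nat.succ_pos N, ?_⟩
  rw [Hom.ker_toSubmodule, Hom.range_toSubmodule, Hom.npow_toLinearMap]
  exact hN (N + 1) (Nat.le_succ N)

/-- **Fitting's lemma for an indecomposable MHS: every endomorphism is bijective or nilpotent.**
[cite: CattaniElZeinGriffithsLe2014, Thm. 3.2.18 and p. 270] -/
theorem IsIndecomposable.bijective_or_isNilpotent (h : H.IsIndecomposable) (f : Hom H H) :
    Function.Bijective f.toLinearMap ∨ IsNilpotent f.toLinearMap := by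
  obtain ⟨n, hn, hc⟩ := f.exists_isCompl_ker_npow_range_npow
  rcases h.2 _ _ hc with hk | hr
  · left
    rw [Hom.ker_toSubmodule, Hom.npow_toLinearMap] at hk
    have hinj : Function.Injective f.toLinearMap := by
      rw [← LinearMap.ker_eq_bot, eq_bot_iff, ← hk]
      obtain ⟨m, rfl⟩ := Nat.exists_eq_succ_of_ne_zero hn.ne'
      rw [pow_succ, Module.End.mul_eq_comp]
      exact LinearMap.ker_le_ker_comp _ _
    exact ⟨hinj, LinearMap.injective_iff_surjective.1 hinj⟩
  · right
    rw [Hom.range_toSubmodule, Hom.npow_toLinearMap, LinearMap.range_eq_bot] at hr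
    exact ⟨n, hr⟩

/-- **`End_MHS(H)` is local for indecomposable `H`: `f` or `id − f` is an isomorphism.**
[cite: CattaniElZeinGriffithsLe2014, Thm. 3.2.18 and p. 270] -/
theorem IsIndecomposable.bijective_or_bijective_id_sub (h : H.IsIndecomposable) (f : Hom H H) :
    Function.Bijective f.toLinearMap ∨ Function.Bijective ((Hom.id H).sub f).toLinearMap := by
  rcases h.bijective_or_isNilpotent f with hb | hn
  · exact Or.inl hb
  · right
    rw [Hom.sub_toLinearMap, Hom.id_toLinearMap, ← Module.End.isUnit_iff]
    exact hn.isUnit_one_sub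

/-- A non-bijective endomorphism of an indecomposable MHS is nilpotent. [cite: CattaniElZeinGriffithsLe2014, p. 270] -/
theorem IsIndecomposable.isNilpotent_of_not_bijective (h : H.IsIndecomposable) (f : Hom H H)
    (hf : ¬Function.Bijective f.toLinearMap) : IsNilpotent f.toLinearMap :=
  (h.bijective_or_isNilpotent f).resolve_left hf

/-- A non-injective endomorphism of an indecomposable MHS is nilpotent. [cite: CattaniElZeinGriffithsLe2014, p. 270] -/
theorem IsIndecomposable.isNilpotent_of_not_injective (h : H.IsIndecomposable) (f : Hom H H)
    (hf : ¬Function.Injective f.toLinearMap) : IsNilpotent f.toLinearMap :=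
  h.isNilpotent_of_not_bijective f fun hb => hf hb.1

end Fitting

/-! ### §4 Indecomposable direct summands exist -/

section Summand

variable [FiniteDimensional ℚ V]

omit [FiniteDimensional ℚ V] in
/-- A sub-summand of a direct summand is a direct summand: if `H = S ⊕ T` and `S = S₁ ⊕ S₂` (inside `S`) then
`H = S₁ ⊕ (S₂ + T)`. [cite: CattaniElZeinGriffithsLe2014, Thm. 3.2.18] -/
theorem isCompl_ofSub_sup (S T : SubMixedHodgeStructure H) (hST : IsCompl S.toSubmodule T.toSubmodule)
    (S₁ S₂ : SubMixedHodgeStructure S.toMixedHodgeStructure) (h₁₂ : IsCompl S₁.toSubmodule S₂.toSubmodule) :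
    IsCompl (S.ofSub S₁).toSubmodule ((S.ofSub S₂).sup T).toSubmodule := by
  rw [SubMixedHodgeStructure.sup_toSubmodule, SubMixedHodgeStructure.ofSub_toSubmodule,
    SubMixedHodgeStructure.ofSub_toSubmodule]
  refine ⟨disjoint_iff.2 (eq_bot_iff.2 ?_), codisjoint_iff.2 (eq_top_iff.2 fun x _ => ?_)⟩
  · rintro x ⟨hx₁, hx₂⟩
    obtain ⟨a, ha, rfl⟩ := Submodule.mem_map.1 hx₁
    obtain ⟨y, hy, t, ht, hyt⟩ := Submodule.mem_sup.1 hx₂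
    obtain ⟨b, hb, rfl⟩ := Submodule.mem_map.1 hy
    -- `t = a - b ∈ S ∩ T = 0`, so `a = b ∈ S₁ ∩ S₂ = 0`
    have htS : t ∈ S.toSubmodule := by
      rw [show t = S.toSubmodule.subtype a - S.toSubmodule.subtype b by rw [← hyt]; abel]
      exact S.toSubmodule.sub_mem a.2 b.2
    have ht0 : t = 0 := by
      have h := Submodule.mem_inf.2 ⟨htS, ht⟩
      rwa [hST.inf_eq_bot, Submodule.mem_bot] at h
    rw [ht0, add_zero] at hyt
    have hab : a = b := (Subtype.ext hyt).symm
    have ha0 : a ∈ S₁.toSubmodule ⊓ S₂.toSubmodule := Submodule.mem_inf.2 ⟨ha, hab ▸ hb⟩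
    rw [h₁₂.inf_eq_bot, Submodule.mem_bot] at ha0
    rw [Submodule.mem_bot, ha0, map_zero]
  · obtain ⟨s, hs, t, ht, rfl⟩ := Submodule.mem_sup.1 (show x ∈ S.toSubmodule ⊔ T.toSubmodule by
      rw [hST.sup_eq_top]; exact Submodule.mem_top)
    have hs' : (⟨s, hs⟩ : ↥S.toSubmodule) ∈ S₁.toSubmodule ⊔ S₂.toSubmodule := by
      rw [h₁₂.sup_eq_top]; exact Submodule.mem_top
    obtain ⟨a, ha, b, hb, hab⟩ := Submodule.mem_sup.1 hs'
    have hs_eq : s = (a : V) + (b : V) := by rw [← Submodule.coe_add, hab]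
    rw [hs_eq, add_assoc]
    exact Submodule.add_mem_sup ⟨a, ha, rfl⟩ (Submodule.add_mem_sup ⟨b, hb, rfl⟩ ht)

variable (H)

/-- There are direct summands of positive dimension (`H` itself). [cite: CattaniElZeinGriffithsLe2014, Thm. 3.2.18] -/
private theorem exists_summand [Nontrivial V] : ∃ k : ℕ, 0 < k ∧ ∃ S T : SubMixedHodgeStructure H,
    IsCompl S.toSubmodule T.toSubmodule ∧ finrank ℚ S.toSubmodule = k :=
  ⟨finrank ℚ V, finrank_pos, SubMixedHodgeStructure.top H, SubMixedHodgeStructure.bot H, by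
    rw [SubMixedHodgeStructure.top_toSubmodule, SubMixedHodgeStructure.bot_toSubmodule]; exact isCompl_top_bot, by
    rw [SubMixedHodgeStructure.top_toSubmodule, finrank_top]⟩

/-- **Every non-zero MHS has an indecomposable direct summand** (a direct summand of least positive dimension is
indecomposable: a proper decomposition of it would give a smaller summand of `H`).
[cite: CattaniElZeinGriffithsLe2014, Thm. 3.2.18 and p. 270] -/
theorem exists_isCompl_isIndecomposable [Nontrivial V] : ∃ S T : SubMixedHodgeStructure H,
    IsCompl S.toSubmodule T.toSubmodule ∧ S.toMixedHodgeStructure.IsIndecomposable := by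
  classical
  obtain ⟨hk, S, T, hST, hSk⟩ := Nat.find_spec (exists_summand H)
  have hmin : ∀ m < Nat.find (exists_summand H), ¬(0 < m ∧ ∃ S T : SubMixedHodgeStructure H,
      IsCompl S.toSubmodule T.toSubmodule ∧ finrank ℚ S.toSubmodule = m) := fun m hm => Nat.find_min _ hm
  refine ⟨S, T, hST, ?_, fun S₁ S₂ h₁₂ => ?_⟩
  · -- `S ≠ 0`
    rw [← finrank_pos_iff (R := ℚ), hSk]
    exact hk
  · by_contra hne
    rw [not_or] at hne
    obtain ⟨h1ne, h2ne⟩ := hne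
    -- `S₁` is a direct summand of `H` (complement `S₂ + T`) of smaller positive dimension
    have hdim1 : finrank ℚ (S.ofSub S₁).toSubmodule = finrank ℚ S₁.toSubmodule := by
      rw [SubMixedHodgeStructure.ofSub_toSubmodule]
      exact (LinearEquiv.finrank_eq
        (Submodule.equivMapOfInjective _ (Submodule.injective_subtype S.toSubmodule) S₁.toSubmodule)).symm
    have hpos1 : 0 < finrank ℚ S₁.toSubmodule :=
      Nat.pos_of_ne_zero fun h0 => h1ne (Submodule.finrank_eq_zero.1 h0)
    have hpos2 : 0 < finrank ℚ S₂.toSubmodule :=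
      Nat.pos_of_ne_zero fun h0 => h2ne (Submodule.finrank_eq_zero.1 h0)
    have hsum := Submodule.finrank_add_eq_of_isCompl h₁₂
    have hlt : finrank ℚ S₁.toSubmodule < Nat.find (exists_summand H) := by rw [← hSk]; omega
    exact hmin _ hlt ⟨hpos1, S.ofSub S₁, (S.ofSub S₂).sup T, isCompl_ofSub_sup S T hST S₁ S₂ h₁₂, hdim1⟩

/-- In particular an indecomposable sub-MHS exists in every non-zero MHS. [cite: CattaniElZeinGriffithsLe2014, p. 270] -/
theorem exists_subMixedHodgeStructure_isIndecomposable [Nontrivial V] :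
    ∃ S : SubMixedHodgeStructure H, S.toMixedHodgeStructure.IsIndecomposable := by
  obtain ⟨S, -, -, hS⟩ := exists_isCompl_isIndecomposable H
  exact ⟨S, hS⟩

end Summand

end MixedHodgeStructure

end Literature.AlgebraicGeometry.Motives
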